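import Summits.PneNP.PneNP.Theses.RootDecompMagnificationPayout
import Literature.Computability.MetaComplexity.GapMCSPLightConeLowerBound

/-!
# `RootDecompMagnificationPayout.WindowFloor` (stmt-PneNP-32098) — the proved floor of the gap-MCSP window dial

Node N40 of the decomp-pnenp root-decomposition cell (route `route-PneNP-RootDecompMagnificationPayout`,
lens-1 g10 «MagnificationPayout») cuts the root on the gap-MCSP circuit-size window `N·log^q N` between
the PROVED floor and the Oliveira–Pich–Santhanam magnification threshold `N^{1+ε}`.  The floor is a
tree theorem: for `0 ≤ β < β′ < 1` and every `c`, `Gap-MCSP[2^{βn}/(cn), 2^{βn}]` is not separated by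
`B₂`-circuit families of eventually `≤ N − ⌈N^{β′}⌉` gates (`gapMCSP_not_mem_SIZEae_sublinear`, counting
YES instances against the light cone).  This file lands the aside recording it (BC5 floor rung; lens
kernel `rung_sublinear`, writer pack `windowFloor_holds`).  0 sorry.
-/

namespace Summit.PneNP.PneNP.Theorems

open Filter Literature.Computability.Complexity Literature.Computability.MetaComplexity

/-- The floor rung of the window dial (stmt-PneNP-32098, `WindowFloor`): the OPS gap-MCSP problem is
outside `SIZEae (N − ⌈N^{β′}⌉)` for all `0 ≤ β < β′ < 1` and every `c` — the tree theorem
`gapMCSP_not_mem_SIZEae_sublinear` at `b = noBound β` (port of the lens-1 g10 kernel `rung_sublinear`;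
decomp-pnenp cell, 2026-08-30). -/
theorem windowFloor_proof :
    Summit.PneNP.PneNP.Theses.RootDecompMagnificationPayout.WindowFloor := by
  unfold Summit.PneNP.PneNP.Theses.RootDecompMagnificationPayout.WindowFloor
  intro c β β' hβ hββ' hβ'1
  exact gapMCSP_not_mem_SIZEae_sublinear hβ hββ' hβ'1 (Eventually.of_forall fun _ => le_rfl)

end Summit.PneNP.PneNP.Theorems
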